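import Summits.BirchSwinnertonDyer.BirchSwinnertonDyer.Theorems.KimAtThreeFineKatoSemiLocalAssembly
import Summits.BirchSwinnertonDyer.BirchSwinnertonDyer.Theorems.KimAtThreeFineKatoTwoExpRiderAssembly
import HarnessLib

/-!
# Item 20398 `FineKatoTwoExpDefectThree` (route W2 `KimAtThreeKolyvagin`; the additive-defect `t = 0` rows of the
# cruxes 19599 / 19679 / 19077): its body — the TWO-EXPONENT fine Kato package — on EVERY additive `t = 0` row,
# from the PER-FACTOR defined-Kato package `hKlocᵃ` (kim3 gen 14's `hKloc` with the two Kato-stratum binders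
# `3 ∤ c₃` / `3 ∤ c_P` DELETED), the semi-local tensor algebra and the rider done in the kernel
# (cell `bsd-addord`, seat w2-acc3 gen 9; helper, `--supports stmt-BirchSwinnertonDyer-20398`)

HONEST FRAMING.  ONE tool theorem (no definition, no named fact, no instance, no `sorry`); `hKlocᵃ` is a DISPLAYED
hypothesis; closes nothing; nothing is booked; BSD is not proved by any of this.  This is kim3 gen 14's
`KimAtThreeFineKatoSemiLocalAssembly.fineKato_of_perFactorKatoPackage` (19560's `stub_fineKato` ⟸ `hKloc`) RE-RUN
off the Kato stratum: the hypothesis `hKlocᵃ` is `hKloc` VERBATIM except that the two stratum binder lines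
`¬ 3 ∣ c₃ →` and `¬ 3 ∣ c_P →` are deleted (so it quantifies over EVERY additive `t = 0` tower row with a
lattice-optimal parametrisation at the conductor: `htow`, `Addv W 3`, `#E(ℚ₃)[3] = 1`, `v₃ ∣ 3`, `P`, `N =
conductor`, lattice-optimality), and the conclusion is the BODY of item 20398 (`∃ ι κK Λ Λfin e`, `κK` a `3`-adic-unit
rational, clause (i) at every depth, the TWO-EXPONENT compatibility (ii₂) at every depth, Kato's `ZetaBody`
family) on those rows — with `e := v₃(c₃)` supplied by this seat's c₃-free rider assembly
`KimAtThreeFineKatoTwoExpRiderAssembly.exists_fineKatoTwoExp_of_semiLocalInt`.  The per-factor → semi-local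
transport (`Λ₀ := L_int′ ∩ Ψ⁻¹(∏Λ₀ʷ)`, `M := ℤ₃⟨Ψ⁻¹(∏Mʷ)⟩`, unit-trace element, `Tr = e₃⁻¹ Σ_w Tr_w`) is kim3's
`semiLocalInt_package_of_perFactor` BY NAME, unchanged.  Every clause of `hKlocᵃ` is a statement inside ONE local
field: `φ = exp*_ω` at `ℚ₃` with `hker`/`hdual` ([BK90] 3.8/3.11, Tate duality); per `w ∣ 3` of `ℚ(ζ_m)` the
log-lattice `Λ₀ʷ ⊆ 𝒪_w` with a unit-trace element at one `w₀` (kport `consumer_of_addv` — needs `Addv` and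
unramified `w`, NOT `c₃`), `Mʷ = exp*_w(H¹(L_w, T))` with `Tr(Mʷ·Λ₀ʷ) ⊆ ℤ₃` ((S5b) over `L_w`), the per-factor
COMPAT (exactness over `L_w`, `exp*` restriction-functoriality, Kato-v2's DEFINITION of `Λ`), R-κ, `ZetaBody`.
The item BY NAME (restriction to its `3 ∣ c₃ ∨ 3 ∣ c_P` rows) is the sibling `KimAtThreeFineKatoTwoExpItem`.

References: S. Bloch, K. Kato (1990) §3 Prop. 3.8, Ex. 3.11 [BlochKato1990]; K. Kato, Astérisque 295 (2004)
(8.1.3), 8.12, §9.4, Thm. 9.7, Thm. 6.6 (1), Ex. 13.3 [Kato2004Asterisque]; C.-H. Kim, AJM 148 (2026)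
§3.2.3, Lemma 3.10, §3.3–§3.4.1, Thm. 3.13 [Kim2022StructureSelmer]; C.-H. Kim, K. Nakamura, JNT 210 (2020) Thm. 2.1 /
Cor. 2.4 [KimNakamura2020]; J. W. S. Cassels, A. Fröhlich (1967) Ch. II §10 (10.2) [CasselsFrohlichANT1967];
n1011 ROUTE-1 §17 F-b, §53.3 (LEMMA SAT, D-53-1/D-53-6); kim3 memos KIM3-W2-C1-g11 §2.4, KIM3-W2-C1b-KERNEL-g13 §3.
-/
noncomputable section

-- the cell's Theorems namespace `Summit.BirchSwinnertonDyer.BirchSwinnertonDyer.…` repeats the summit name by design (D-0017)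
set_option linter.dupNamespace false

open scoped Classical NumberField TensorProduct ContRepresentation
open Field NumberField IsDedekindDomain
open WeierstrassCurve Literature.NumberTheory.EllipticCurves Literature.NumberTheory.GaloisRepresentations
  Literature.NumberTheory.GaloisRepresentations.DiscreteGaloisModule Literature.NumberTheory.GaloisCohomology
open Literature.NumberTheory.EllipticCurves.ModularForms Literature.NumberTheory.EllipticCurves.Rank1Residual
open Literature.NumberTheory.EllipticCurves.Kato2004 Literature.NumberTheory.EllipticCurves.Kato2004.EulerSystemValues
open Literature.NumberTheory.AdelicBaseChange
open Summit.BirchSwinnertonDyer.Rank1Residual.GaloisImage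
open Summit.BirchSwinnertonDyer.Rank1Residual.Additive.LocalLog
open Summit.BirchSwinnertonDyer.BirchSwinnertonDyer.Theorems
open Summit.BirchSwinnertonDyer.BirchSwinnertonDyer.Theorems.KimAtThreePortSharedSATCore
open Summit.BirchSwinnertonDyer.BirchSwinnertonDyer.Theorems.KimAtThreeFineKatoSemiLocalLatticeInt
open Summit.BirchSwinnertonDyer.BirchSwinnertonDyer.Theorems.KimAtThreeFineKatoSemiLocalTransport

namespace Summit.BirchSwinnertonDyer.BirchSwinnertonDyer.Theorems.KimAtThreeFineKatoTwoExpOfPerFactor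

set_option maxHeartbeats 400000 in
/-- **The body of item 20398 (`FineKatoTwoExpDefectThree`: `∃ ι κK Λ Λfin e`, R-κ, clause (i), the two-exponent
compatibility (ii₂) at every depth, `ZetaBody`) on EVERY additive `t = 0` tower row, FROM THE PER-FACTOR
DEFINED-KATO PACKAGE `hKlocᵃ`** = kim3 gen 14's `hKloc` (`KimAtThreeFineKatoSemiLocalAssembly.fineKato_of_perFactorKatoPackage`)
with the two Kato-stratum binders `¬ 3 ∣ c₃` / `¬ 3 ∣ c_P` deleted and nothing else changed: `φ = exp*_ω` on
`H¹(ℚ₃, T₃W)` with `hker`/`hdual`; per depth `j`, tame level `r` and ANY semi-local isomorphism `Ψ` with the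
pure-tensor formula, per-factor sets `Λ₀ʷ ⊆ 𝒪_w ∋ 0`, `Mʷ` with `e₃⁻¹Tr_{L_w/ℚ_v}(Mʷ·Λ₀ʷ) ⊆ ℤ₃`, ONE factor `w₀`
with a unit-trace element of `Λ₀^{w₀}`, and the PER-FACTOR COMPAT `Ψ(φ(h) ⊗ 1 − 3⁰·Λ_{0,r}(y))_w ∈ 3^{j+1}·Mʷ`;
R-κ; `ZetaBody`.  Proof: kim3's transport `semiLocalInt_package_of_perFactor` (w2-acc4's `Ψ`/trace/`L_int′`
algebra) gives the semi-local package in the `L_int′` currency, and this seat's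
`KimAtThreeFineKatoTwoExpRiderAssembly.exists_fineKatoTwoExp_of_semiLocalInt` builds `Λfin` and proves (i) and
(ii₂) with `e = v₃(c₃)` — NO use of `c₃` or `c_P` anywhere.  `hKlocᵃ` displayed; closes nothing.
[cite: Kato2004Asterisque, (8.1.3) (p. 180), Prop. 8.12 (p. 186), §9.4 and Thm. 9.7 (pp. 188–189), Thm. 6.6 (1) (p. 163), Ex. 13.3 (pp. 224–225)]
[cite: BlochKato1990, §3 (Prop. 3.8, Ex. 3.11)] [cite: Kim2022StructureSelmer, §3.2.3, Lemma 3.10, §3.3–§3.4.1 and Thm. 3.13]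
[cite: CasselsFrohlichANT1967, Ch. II §10 Theorem (10.2)] -/
theorem fineKatoTwoExp_of_perFactorKatoPackage
    (hKloc : ∀ (W : WeierstrassCurve ℚ) [W.IsElliptic] [W.IsGloballyMinimal]
      [ContinuousSMul ℤ_[3] (W.tateModule 3)] [Module.Free ℤ_[3] (W.tateModule 3)]
      [Module.Finite ℤ_[3] (W.tateModule 3)],
      (∀ m : ℕ, W.HasSurjectiveModNGaloisRep (3 ^ m : ℕ)) →
      (haveI : Fact (Nat.Prime 3) := ⟨Nat.prime_three⟩; Addv W 3) →
      Nat.card {Q : (W.baseChange ℚ_[3]).toAffine.Point // (3 : ℕ) • Q = 0} = 1 →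
      ∀ (v₃ : HeightOneSpectrum (𝓞 ℚ)), ((3 : ℕ) : 𝓞 ℚ) ∈ v₃.asIdeal →
      ∀ {N : ℕ} [NeZero N] (P : ModularParametrizationData W N), N = W.conductorNorm ℤ →
        (∀ z ∈ P.L.lattice, ∃ w ∈ periodLattice P.f, z = P.c * w) →
        ∃ (ι : (n : ℕ) → (CyclotomicField n ℚ →+* ℂ)) (κK : ℝ)
          (Λ : ∀ (k' : ℕ) (r : Finset (HeightOneSpectrum (𝓞 ℚ))),
            H1 (tateRep W 3) (cycSubgroup 3 k' r) →ₗ[ℤ_[3]]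
              ℚ_[3] ⊗[ℚ] CyclotomicField (cycLevel 3 k' r) ℚ)
          (φ : (tateLocalRep W 3 (Sum.inr v₃)).cohomology 1 →+ ℚ_[3]),
          κK ≠ 0 ∧ (∃ u : ℚ, (u : ℝ) = κK ∧ padicValRat 3 u = 0) ∧
          (∀ y, φ y = 0 ↔ ∀ j : ℕ, tateLocalMap W 3 j (Sum.inr v₃) y ∈
            W.kummerSelmerStructure (((3 : ℕ) : ℤ) ^ j * ((3 : ℕ) : ℤ)) (Sum.inr v₃)) ∧
          (∀ a : ℚ_[3], (∃ y, φ y = a) ↔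
            ∀ Q : (W.baseChange ℚ_[3]).toAffine.Point, ‖a * padicLog (W.baseChange ℚ_[3]) Q‖ ≤ 1) ∧
          (∀ (j : ℕ) (r : Finset (HeightOneSpectrum (𝓞 ℚ)))
            (Ψ : ℚ_[3] ⊗[ℚ] CyclotomicField (cycLevel 3 0 r) ℚ ≃ₐ[ℚ]
              (Π w : ((Rat.HeightOneSpectrum.primesEquiv (R := 𝓞 ℚ)).symm ⟨3, Fact.out⟩).Extension
                (𝓞 (CyclotomicField (cycLevel 3 0 r) ℚ)), w.1.adicCompletion (CyclotomicField (cycLevel 3 0 r) ℚ))),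
            (∀ (s : ℚ_[3]) (x : CyclotomicField (cycLevel 3 0 r) ℚ)
              (w : ((Rat.HeightOneSpectrum.primesEquiv (R := 𝓞 ℚ)).symm ⟨3, Fact.out⟩).Extension
                (𝓞 (CyclotomicField (cycLevel 3 0 r) ℚ))),
              Ψ (s ⊗ₜ[ℚ] x) w =
                algebraMap (CyclotomicField (cycLevel 3 0 r) ℚ) (w.1.adicCompletion (CyclotomicField (cycLevel 3 0 r) ℚ)) x *
                algebraMap (((Rat.HeightOneSpectrum.primesEquiv (R := 𝓞 ℚ)).symm ⟨3, Fact.out⟩).adicCompletion ℚ)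
                  (w.1.adicCompletion (CyclotomicField (cycLevel 3 0 r) ℚ)) (Padic.adicCompletionEquiv (𝓞 ℚ) ⟨3, Fact.out⟩ s)) →
            ∃ (Λ₀' M' : ∀ w : ((Rat.HeightOneSpectrum.primesEquiv (R := 𝓞 ℚ)).symm ⟨3, Fact.out⟩).Extension
                (𝓞 (CyclotomicField (cycLevel 3 0 r) ℚ)), Set (w.1.adicCompletion (CyclotomicField (cycLevel 3 0 r) ℚ))),
              (∀ w, Λ₀' w ⊆ w.1.adicCompletionIntegers (CyclotomicField (cycLevel 3 0 r) ℚ)) ∧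
              (∀ w, (0 : w.1.adicCompletion (CyclotomicField (cycLevel 3 0 r) ℚ)) ∈ Λ₀' w) ∧
              (∃ w₀, ∃ ℓ₀ ∈ Λ₀' w₀, ‖(Padic.adicCompletionEquiv (𝓞 ℚ) ⟨3, Fact.out⟩).symm
                (Algebra.trace (((Rat.HeightOneSpectrum.primesEquiv (R := 𝓞 ℚ)).symm ⟨3, Fact.out⟩).adicCompletion ℚ)
                  (w₀.1.adicCompletion (CyclotomicField (cycLevel 3 0 r) ℚ)) ℓ₀)‖ = 1) ∧
              (∀ w, ∀ μ ∈ M' w, ∀ ℓ ∈ Λ₀' w, ‖(Padic.adicCompletionEquiv (𝓞 ℚ) ⟨3, Fact.out⟩).symm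
                (Algebra.trace (((Rat.HeightOneSpectrum.primesEquiv (R := 𝓞 ℚ)).symm ⟨3, Fact.out⟩).adicCompletion ℚ)
                  (w.1.adicCompletion (CyclotomicField (cycLevel 3 0 r) ℚ)) (μ * ℓ))‖ ≤ 1) ∧
              ∀ (Ψ' : H1 (tateRep W 3) (cycSubgroup 3 0 r) →+
                  continuousCohomology 1 (subgroupRep
                    (W.torsionGaloisModule (((3 : ℕ) : ℤ) ^ j * ((3 : ℕ) : ℤ))).toTopRep (cycSubgroup 3 0 r))),
                (∀ (φ' : contOneCocycles (subgroupRep (tateRep W 3).toTopRep (cycSubgroup 3 0 r)))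
                    (ψ : contOneCocycles (subgroupRep
                      (W.torsionGaloisModule (((3 : ℕ) : ℤ) ^ j * ((3 : ℕ) : ℤ))).toTopRep (cycSubgroup 3 0 r))),
                    (∀ g, ((ψ.1 g : geomTorsion W (((3 : ℕ) : ℤ) ^ j * ((3 : ℕ) : ℤ))) : geomPoints W) =
                      TateModule.proj 3 (j + 1) (φ'.1 g)) →
                    Ψ' (oneCocycleClass _ φ') = oneCocycleClass _ ψ) →
                ∀ (y : H1 (tateRep W 3) (cycSubgroup 3 0 r))
                  (κ₀ : galoisCohomology (W.torsionGaloisModule (((3 : ℕ) : ℤ) ^ j * ((3 : ℕ) : ℤ))) 1)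
                  (h : (tateLocalRep W 3 (Sum.inr v₃)).cohomology 1),
                  resSubgroup (W.torsionGaloisModule (((3 : ℕ) : ℤ) ^ j * ((3 : ℕ) : ℤ))).toTopRep
                      (cycSubgroup 3 0 r) 1 κ₀ = Ψ' y →
                  galoisCohomology.localization (W.torsionGaloisModule (((3 : ℕ) : ℤ) ^ j * ((3 : ℕ) : ℤ)))
                      (Sum.inr v₃) 1 κ₀ = tateLocalMap W 3 j (Sum.inr v₃) h →
                  ∀ w, ∃ μ ∈ M' w,
                    Ψ ((φ h ⊗ₜ[ℚ] (1 : CyclotomicField (cycLevel 3 0 r) ℚ)) -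
                        (((3 : ℕ) : ℤ_[3]) ^ (0 : ℕ)) • Λ 0 r y) w =
                      (((3 : ℕ) : w.1.adicCompletion (CyclotomicField (cycLevel 3 0 r) ℚ)) ^ (j + 1)) * μ) ∧
          ∀ (c d a : ℤ) (A : ℕ), 0 < A → Int.gcd c (6 * 3 * A) = 1 → Int.gcd d (6 * 3 * N) = 1 →
            ∃ (z : ∀ (k' : ℕ) (r : (cyclotomicLevelsRat 3 (badPlaces c d A N)).Ideals),
                  H1 (tateRep W 3) ((cyclotomicLevelsRat 3 (badPlaces c d A N)).level k' r.1))
              (x : ∀ (k' : ℕ) (r : (cyclotomicLevelsRat 3 (badPlaces c d A N)).Ideals),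
                  CyclotomicField (cycLevel 3 k' r.1) ℚ),
              ZetaBody W 3 P.f ι κK Λ c d a A z x) :
    ∀ (W : WeierstrassCurve ℚ) [W.IsElliptic] [W.IsGloballyMinimal]
      [ContinuousSMul ℤ_[3] (W.tateModule 3)] [Module.Free ℤ_[3] (W.tateModule 3)]
      [Module.Finite ℤ_[3] (W.tateModule 3)],
      (∀ m : ℕ, W.HasSurjectiveModNGaloisRep (3 ^ m : ℕ)) →
      (haveI : Fact (Nat.Prime 3) := ⟨Nat.prime_three⟩; Addv W 3) →
      Nat.card {Q : (W.baseChange ℚ_[3]).toAffine.Point // (3 : ℕ) • Q = 0} = 1 →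
      ∀ (v₃ : HeightOneSpectrum (𝓞 ℚ)), ((3 : ℕ) : 𝓞 ℚ) ∈ v₃.asIdeal →
      ∀ {N : ℕ} [NeZero N] (P : ModularParametrizationData W N), N = W.conductorNorm ℤ →
        (∀ z ∈ P.L.lattice, ∃ w ∈ periodLattice P.f, z = P.c * w) →
        ∃ (ι : (n : ℕ) → (CyclotomicField n ℚ →+* ℂ)) (κK : ℝ)
          (Λ : ∀ (k' : ℕ) (r : Finset (HeightOneSpectrum (𝓞 ℚ))),
            H1 (tateRep W 3) (cycSubgroup 3 k' r) →ₗ[ℤ_[3]]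
              ℚ_[3] ⊗[ℚ] CyclotomicField (cycLevel 3 k' r) ℚ)
          (Λfin : ∀ j : ℕ, galoisCohomology
            ((W.torsionGaloisModule (((3 : ℕ) : ℤ) ^ j * ((3 : ℕ) : ℤ))).toLocal (Sum.inr v₃)) 1 →+
              ZMod (3 ^ (j + 1))) (e : ℕ),
          κK ≠ 0 ∧ (∃ u : ℚ, (u : ℝ) = κK ∧ padicValRat 3 u = 0) ∧
          (∀ j : ℕ, (∀ c : ZMod (3 ^ (j + 1)), ∃ x ∈ propagatedSelmerStructure W 3 j (Sum.inr v₃), Λfin j x = c) ∧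
            (∀ x ∈ propagatedSelmerStructure W 3 j (Sum.inr v₃),
              Λfin j x = 0 ↔ x ∈ W.kummerSelmerStructure (((3 : ℕ) : ℤ) ^ j * ((3 : ℕ) : ℤ)) (Sum.inr v₃))) ∧
          (∀ j : ℕ, ∀ (r : Finset (HeightOneSpectrum (𝓞 ℚ)))
            (Ψ : H1 (tateRep W 3) (cycSubgroup 3 0 r) →+
              continuousCohomology 1 (subgroupRep
                (W.torsionGaloisModule (((3 : ℕ) : ℤ) ^ j * ((3 : ℕ) : ℤ))).toTopRep (cycSubgroup 3 0 r))),
            (∀ (φ' : contOneCocycles (subgroupRep (tateRep W 3).toTopRep (cycSubgroup 3 0 r)))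
                (ψ : contOneCocycles (subgroupRep
                  (W.torsionGaloisModule (((3 : ℕ) : ℤ) ^ j * ((3 : ℕ) : ℤ))).toTopRep (cycSubgroup 3 0 r))),
                (∀ g, ((ψ.1 g : geomTorsion W (((3 : ℕ) : ℤ) ^ j * ((3 : ℕ) : ℤ))) : geomPoints W) =
                  TateModule.proj 3 (j + 1) (φ'.1 g)) →
                Ψ (oneCocycleClass _ φ') = oneCocycleClass _ ψ) →
            ∀ (y : H1 (tateRep W 3) (cycSubgroup 3 0 r))
              (κ₀ : galoisCohomology (W.torsionGaloisModule (((3 : ℕ) : ℤ) ^ j * ((3 : ℕ) : ℤ))) 1) (s : ℤ_[3]),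
              resSubgroup (W.torsionGaloisModule (((3 : ℕ) : ℤ) ^ j * ((3 : ℕ) : ℤ))).toTopRep
                  (cycSubgroup 3 0 r) 1 κ₀ = Ψ y →
              galoisCohomology.localization (W.torsionGaloisModule (((3 : ℕ) : ℤ) ^ j * ((3 : ℕ) : ℤ)))
                  (Sum.inr v₃) 1 κ₀ ∈ propagatedSelmerStructure W 3 j (Sum.inr v₃) →
              (∃ l ∈ cycIntLattice 3 (cycLevel 3 0 r),
                (((3 : ℕ) : ℤ_[3]) ^ 0) • Λ 0 r y - ((s : ℚ_[3]) ⊗ₜ[ℚ] (1 : CyclotomicField (cycLevel 3 0 r) ℚ)) =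
                  (((3 : ℕ) : ℤ_[3]) ^ (j + 1)) • (l : ℚ_[3] ⊗[ℚ] CyclotomicField (cycLevel 3 0 r) ℚ)) →
              ((3 ^ e : ℕ) : ZMod (3 ^ (j + 1))) *
                  Λfin j (galoisCohomology.localization (W.torsionGaloisModule (((3 : ℕ) : ℤ) ^ j * ((3 : ℕ) : ℤ)))
                    (Sum.inr v₃) 1 κ₀) = PadicInt.toZModPow (j + 1) s) ∧
          ∀ (c d a : ℤ) (A : ℕ), 0 < A → Int.gcd c (6 * 3 * A) = 1 → Int.gcd d (6 * 3 * N) = 1 →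
            ∃ (z : ∀ (k' : ℕ) (r : (cyclotomicLevelsRat 3 (badPlaces c d A N)).Ideals),
                  H1 (tateRep W 3) ((cyclotomicLevelsRat 3 (badPlaces c d A N)).level k' r.1))
              (x : ∀ (k' : ℕ) (r : (cyclotomicLevelsRat 3 (badPlaces c d A N)).Ideals),
                  CyclotomicField (cycLevel 3 k' r.1) ℚ),
              ZetaBody W 3 P.f ι κK Λ c d a A z x  := by
  intro W _ _ _ _ _ htow hadd ht v₃ hv₃ N _ P hN hlat
  obtain ⟨ι, κK, Λ, φ, hκ0, hκu, hker, hdual, hloc, hz⟩ := hKloc W htow hadd ht v₃ hv₃ P hN hlat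
  have hsemi : ∀ (j : ℕ) (r : Finset (HeightOneSpectrum (𝓞 ℚ))),
      ∃ (Λ₀ : Set (ℚ_[3] ⊗[ℚ] CyclotomicField (cycLevel 3 0 r) ℚ))
        (M : Submodule ℤ_[3] (ℚ_[3] ⊗[ℚ] CyclotomicField (cycLevel 3 0 r) ℚ)),
        Λ₀ ⊆ Submodule.span ℤ_[3] (Set.range fun b : 𝓞 (CyclotomicField (cycLevel 3 0 r) ℚ) ↦
          (1 : ℚ_[3]) ⊗ₜ[ℚ] (b : CyclotomicField (cycLevel 3 0 r) ℚ)) ∧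
        (∃ ℓ ∈ Λ₀, ‖Algebra.trace ℚ_[3] (ℚ_[3] ⊗[ℚ] CyclotomicField (cycLevel 3 0 r) ℚ) ℓ‖ = 1) ∧
        (∀ μ ∈ M, ∀ ℓ ∈ Λ₀,
          ‖Algebra.trace ℚ_[3] (ℚ_[3] ⊗[ℚ] CyclotomicField (cycLevel 3 0 r) ℚ) (μ * ℓ)‖ ≤ 1) ∧
        ∀ (Ψ : H1 (tateRep W 3) (cycSubgroup 3 0 r) →+
            continuousCohomology 1 (subgroupRep
              (W.torsionGaloisModule (((3 : ℕ) : ℤ) ^ j * ((3 : ℕ) : ℤ))).toTopRep (cycSubgroup 3 0 r))),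
          (∀ (φ' : contOneCocycles (subgroupRep (tateRep W 3).toTopRep (cycSubgroup 3 0 r)))
              (ψ : contOneCocycles (subgroupRep
                (W.torsionGaloisModule (((3 : ℕ) : ℤ) ^ j * ((3 : ℕ) : ℤ))).toTopRep (cycSubgroup 3 0 r))),
              (∀ g, ((ψ.1 g : geomTorsion W (((3 : ℕ) : ℤ) ^ j * ((3 : ℕ) : ℤ))) : geomPoints W) =
                TateModule.proj 3 (j + 1) (φ'.1 g)) →
              Ψ (oneCocycleClass _ φ') = oneCocycleClass _ ψ) →
          ∀ (y : H1 (tateRep W 3) (cycSubgroup 3 0 r))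
            (κ₀ : galoisCohomology (W.torsionGaloisModule (((3 : ℕ) : ℤ) ^ j * ((3 : ℕ) : ℤ))) 1)
            (h : (tateLocalRep W 3 (Sum.inr v₃)).cohomology 1),
            resSubgroup (W.torsionGaloisModule (((3 : ℕ) : ℤ) ^ j * ((3 : ℕ) : ℤ))).toTopRep
                (cycSubgroup 3 0 r) 1 κ₀ = Ψ y →
            galoisCohomology.localization (W.torsionGaloisModule (((3 : ℕ) : ℤ) ^ j * ((3 : ℕ) : ℤ)))
                (Sum.inr v₃) 1 κ₀ = tateLocalMap W 3 j (Sum.inr v₃) h →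
            ∃ μ ∈ M, (φ h ⊗ₜ[ℚ] (1 : CyclotomicField (cycLevel 3 0 r) ℚ)) -
                (((3 : ℕ) : ℤ_[3]) ^ (0 : ℕ)) • Λ 0 r y = (((3 : ℕ) : ℤ_[3]) ^ (j + 1)) • (μ : _) := by
    intro j r
    obtain ⟨Ψ, hΨ⟩ := exists_padicTensorAlgEquiv (CyclotomicField (cycLevel 3 0 r) ℚ) 3
    obtain ⟨Λ₀', M', hΛ₀', h0, hu', hM', hcompat⟩ := hloc j r Ψ hΨ
    obtain ⟨Λ₀, M, hΛ₀, hu, hM, htrans⟩ :=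
      semiLocalInt_package_of_perFactor 3 (cycLevel 3 0 r) Ψ hΨ Λ₀' M' hΛ₀' h0 hu' hM'
    refine ⟨Λ₀, M, hΛ₀, hu, hM, ?_⟩
    intro Ψ' hΨ' y κ₀ h hres hloc'
    exact htrans j _ (hcompat Ψ' hΨ' y κ₀ h hres hloc')
  obtain ⟨Λfin, e, -, hI, hII, -⟩ :=
    KimAtThreeFineKatoTwoExpRiderAssembly.exists_fineKatoTwoExp_of_semiLocalInt W hadd ht v₃ hv₃ φ hker hdual Λ hsemi
  exact ⟨ι, κK, Λ, Λfin, e, hκ0, hκu, hI, hII, hz⟩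


end Summit.BirchSwinnertonDyer.BirchSwinnertonDyer.Theorems.KimAtThreeFineKatoTwoExpOfPerFactor

end
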